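import Literature.Computability.Complexity.IrreducibilityLLLBerlekampLoop
import Literature.Computability.Complexity.IrreducibilityLLLPrimeSearch
import Literature.Computability.Complexity.IrreducibilityLLLCriterion
import HarnessLib

/-!
# The LLL irreducibility test for monic integer polynomials, and its correctness (LLL 1982, §3)

Support file for the discharge of the named fact
`Literature.Computability.Complexity.lll_monicIrreducible_mem_P` (irreducibility of monic integer
polynomials is decidable in `P`; Lenstra–Lenstra–Lovász 1982, §3). This file assembles the
decision procedure on a coefficient list `l` (low degree first, the reading `polyOfList`/
`ofCoeffs` of the route) from the pieces proved in the sibling files, and proves it correct: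

  `irredTest l`: trim; reject unless the last entry is `1` (monic) and the degree `n ≥ 1`; accept
  if `n = 1`; find the prime `p` of (3.6) (`goodPrime`, reject if none: `f` is then inseparable,
  hence reducible); one monic irreducible factor `ū` of `f mod p` (`berlekampFactor`, (3.1));
  accept if `deg ū = n`; lift to `u mod p^k` (`henselLift`, (3.2)) with `p^{2k} > precisionBound`;
  reduce the basis of the lattice `L` of (2.3) (`factorInstance`, tree `lllReduce`, (3.3)–(3.4))
  and accept iff the first reduced vector is long: `testBound n |f|² < |b₁|²` ((3.5), Prop. (2.13)).

* `machineBasis`, `machineEntries`, `firstRowSqNorm` (read off the tree's LLL machine, `firstRowSqNorm_eq`),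
  `precisionExp`, `irredTestCore`, `irredTestMonic`, `irredTest`;
* **`irredTest_eq_true_iff`**: `irredTest l = true ↔ (ofCoeffs l).Monic ∧ Irreducible (ofCoeffs l)`.

The polynomial running time (the `CodeFP` realisation of `irredTest`) and the language-level
statement are in the sequel files.

## References

* A. K. Lenstra, H. W. Lenstra Jr., L. Lovász, *Factoring polynomials with rational coefficients*,
  Math. Ann. 261 (1982) 515–534, §3: algorithm (3.1)–(3.5) and Thm. (3.6). [LenstraLenstraLovasz1982]
* M. R. Bremner, *Lattice Basis Reduction*, CRC Press 2011, §15.7 (Fig. 15.11, the LLL factoring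
  algorithm). [Bremner2011]
-/

noncomputable section

namespace Literature.Computability.Complexity

open Polynomial SumcheckMA Literature.Algebra.EuclideanLattices

namespace LLLFactoring

/-! ### The test -/

/-- The basis matrix output by the tree's LLL MACHINE on an instance: the saturated run
`(capStep W)^W (lllStart B)`, `W = lllBudget |encode I|` — the function the `FP` string function
`LLLMachine.lllMachineF` computes on codes (`lllMachineF_encode`), equal to `I.lllReduce.basis` on
nonsingular instances (`LatticeInstance.lllReduce_eq_capRun`). Defined through the machine so that
the test below is LITERALLY what the polynomial-time realisation computes on every input.
[cite: LenstraLenstraLovasz1982, Prop. (1.26)] -/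
def machineBasis (I : LatticeInstance) : Matrix (Fin I.n) (Fin I.n) ℤ :=
  ((capStep (lllBudget I.encode.length))^[lllBudget I.encode.length] (lllStart I.basis)).b

/-- The entries of the machine output in row-major order (the item list of its code). [folklore] -/
def machineEntries (I : LatticeInstance) : List ℤ :=
  List.ofFn fun m : Fin (I.n * I.n) => machineBasis I (finProdFinEquiv.symm m).1 (finProdFinEquiv.symm m).2

/-- The squared length of the first vector of the LLL-reduced basis of the lattice `L` of LLL82 (2.3)
for `(n, d, u, m)`, read off the machine output: the sum of the squares of the first `n` entries.
[cite: LenstraLenstraLovasz1982, (3.4)–(3.5)] -/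
def firstRowSqNorm (n d : ℕ) (U : List ℤ) (m : ℕ) : ℤ :=
  (((machineEntries (factorInstance n d (ofCoeffs U) m)).take n).map fun x => x * x).sum

/-- On a nonsingular instance the machine output is `lllReduce`. [cite: LenstraLenstraLovasz1982, Prop. (1.26)] -/
theorem machineBasis_eq {I : LatticeInstance} (hI : I.IsNonsingular) : machineBasis I = I.lllReduce.basis := by
  have h : (⟨I.n, I.lllReduce.basis⟩ : LatticeInstance) = ⟨I.n, machineBasis I⟩ := I.lllReduce_eq_capRun hI
  simp only [LatticeInstance.mk.injEq, heq_eq_eq, true_and] at h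
  exact h.symm

/-- The first `n` machine entries are the first row. [folklore] -/
theorem take_machineEntries (I : LatticeInstance) (hn : 0 < I.n) :
    (machineEntries I).take I.n = List.ofFn fun j : Fin I.n => machineBasis I ⟨0, hn⟩ j := by
  unfold machineEntries
  refine List.ext_getElem ?_ fun i h₁ h₂ => ?_
  · rw [List.length_take, List.length_ofFn, List.length_ofFn]
    exact min_eq_left (Nat.le_mul_self _)
  · rw [List.length_ofFn] at h₂
    rw [List.getElem_take, List.getElem_ofFn, List.getElem_ofFn]
    simp only [finProdFinEquiv_symm_apply, Fin.divNat, Fin.modNat]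
    congr 1
    · exact Fin.ext (Nat.div_eq_of_lt h₂)
    · exact Fin.ext (Nat.mod_eq_of_lt h₂)

/-- **The machine-read first-row norm is the one of `lllReduce`** on the (nonsingular) lattice
instance of the test. [cite: LenstraLenstraLovasz1982, (3.4)–(3.5)] -/
theorem firstRowSqNorm_eq {n d : ℕ} {U : List ℤ} {m : ℕ} (hI : (factorInstance n d (ofCoeffs U) m).IsNonsingular) (hn : 0 < n) :
    firstRowSqNorm n d U m = ∑ j, (factorInstance n d (ofCoeffs U) m).lllReduce.basis ⟨0, hn⟩ j ^ 2 := by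
  rw [firstRowSqNorm]
  have ht := take_machineEntries (factorInstance n d (ofCoeffs U) m) hn
  change List.take n (machineEntries _) = _ at ht
  rw [ht, List.map_ofFn, List.sum_ofFn]
  have hb := machineBasis_eq hI
  refine Finset.sum_congr rfl fun j _ => ?_
  simp only [Function.comp_apply]
  rw [hb, sq]
  rfl

/-- The exponent `k` of the modulus `p^k`: one more than the bit length of `precisionBound`, so that
`p^k ≥ 2^k > precisionBound` (LLL82 (3.3): "`k` the least positive integer with `p^{kl} > …`"; any
polynomially bounded `k` beyond that works). [cite: LenstraLenstraLovasz1982, (3.3)] -/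
def precisionExp (n : ℕ) (S : ℤ) : ℕ := Nat.size (precisionBound n S).toNat + 1

/-- The core of the test for a monic trimmed `f` of degree `n ≥ 2` and its prime `p`: Berlekamp,
then (unless `f mod p` is irreducible) Hensel, lattice reduction and the length test.
[cite: LenstraLenstraLovasz1982, (3.1)–(3.5)] -/
def irredTestCore (f : List ℤ) (n p : ℕ) : Bool :=
  if (berlekampFactor p (pnorm p f)).length - 1 = n then true else
    decide (testBound n (sqNormList f) <
      firstRowSqNorm n ((berlekampFactor p (pnorm p f)).length - 1)
        (henselLift p (precisionExp n (sqNormList f)) f (berlekampFactor p (pnorm p f)))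
        (p ^ precisionExp n (sqNormList f)))

/-- The test for a monic trimmed `f` (last entry `1`): degree `0` — reject (`f = 1`); degree `1` —
accept; otherwise find the prime of (3.6) (reject if none: `f` is inseparable) and run the core.
[cite: LenstraLenstraLovasz1982, (3.6)] -/
def irredTestMonic (f : List ℤ) : Bool :=
  if f.length - 1 = 0 then false else
  if f.length - 1 = 1 then true else
  match goodPrime f with
  | none => false
  | some p => irredTestCore f (f.length - 1) p

/-- **The irreducibility test** (LLL82 §3 specialised to the decision "is the monic `f` irreducible?"):
trim, check monicity, then `irredTestMonic`. [cite: LenstraLenstraLovasz1982, (3.1)–(3.6)] [cite: Bremner2011, §15.7 Fig. 15.11] -/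
def irredTest (l : List ℤ) : Bool := if (trim l).getLast? = some 1 then irredTestMonic (trim l) else false

/-! ### Reading the trimmed list -/

/-- A nonempty trimmed integer list is its polynomial: degree `|t| - 1`, leading coefficient the
last entry. [folklore] -/
theorem natDegree_ofCoeffs_trim {l : List ℤ} (hne : trim l ≠ []) :
    (ofCoeffs (trim l)).natDegree = (trim l).length - 1 ∧ (ofCoeffs (trim l)).leadingCoeff = (trim l).getLast hne := by
  have hlast : (trim l).getLast hne ≠ 0 := by
    rcases trim_eq_nil_or_getLast l with h | ⟨h, h'⟩
    · exact absurd h hne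
    · exact h'
  have hpos := List.length_pos_of_ne_nil hne
  have hlead : (ofCoeffs (trim l)).coeff ((trim l).length - 1) = (trim l).getLast hne := by
    rw [coeff_ofCoeffs, List.getD_eq_getElem _ _ (by omega), List.getLast_eq_getElem]
  have hdeg : (ofCoeffs (trim l)).natDegree = (trim l).length - 1 := by
    refine le_antisymm ?_ (le_natDegree_of_ne_zero (by rw [hlead]; exact hlast))
    rw [natDegree_le_iff_coeff_eq_zero]
    intro N hN
    rw [coeff_ofCoeffs, List.getD_eq_default _ _ (by omega)]
  exact ⟨hdeg, by rw [leadingCoeff, hdeg, hlead]⟩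

/-- **Monicity is read off the trimmed list**: `ofCoeffs l` is monic iff the trimmed list ends in `1`.
[folklore] -/
theorem monic_iff_getLast?_trim (l : List ℤ) : (ofCoeffs l).Monic ↔ (trim l).getLast? = some 1 := by
  rw [← ofCoeffs_trim]
  by_cases hne : trim l = []
  · rw [hne]
    simp [ofCoeffs, Monic]
  · obtain ⟨-, hlead⟩ := natDegree_ofCoeffs_trim hne
    rw [Monic, hlead, List.getLast?_eq_some_getLast hne, Option.some.injEq]

/-! ### Correctness -/

/-- A monic integer polynomial of degree `1` is irreducible. [folklore] -/
theorem irreducible_of_monic_natDegree_one {F : ℤ[X]} (hF : F.Monic) (h1 : F.natDegree = 1) : Irreducible F := by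
  have hF1 : F ≠ 1 := fun h => by rw [h, natDegree_one] at h1; exact zero_ne_one h1
  rw [irreducible_of_monic hF hF1]
  intro g h hg hh hgh
  have hdeg : g.natDegree + h.natDegree = 1 := by rw [← hg.natDegree_mul hh, hgh, h1]
  rcases Nat.eq_zero_or_pos g.natDegree with h0 | h0
  · exact Or.inl (eq_one_of_monic_natDegree_zero hg h0)
  · exact Or.inr (eq_one_of_monic_natDegree_zero hh (by omega))

/-- The cofactor of an irreducible factor of a squarefree polynomial is coprime to it. [folklore] -/
theorem isCoprime_cofactor {p : ℕ} [Fact p.Prime] {F ū : (ZMod p)[X]} (hsq : Squarefree F)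
    (hirr : Irreducible ū) (hum : ū.Monic) (hdvd : ū ∣ F) : IsCoprime ū (F /ₘ ū) := by
  rw [hirr.coprime_iff_not_dvd]
  intro h2
  have hF : F = ū * (F /ₘ ū) := by
    have := modByMonic_add_div F ū
    rw [(modByMonic_eq_zero_iff_dvd hum).2 hdvd, zero_add] at this
    exact this.symm
  have hsq2 : ū * ū ∣ F := by rw [hF]; exact mul_dvd_mul_left _ h2
  exact hirr.not_isUnit (hsq _ hsq2)

/-- **Correctness of the irreducibility test** (LLL82 Thm. (3.6), decision form): for every integer
coefficient list `l`, `irredTest l = true` iff `ofCoeffs l` is monic and irreducible in `ℤ[X]`.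
[cite: LenstraLenstraLovasz1982, Thm. (3.6) and Prop. (2.13)] -/
theorem irredTest_eq_true_iff (l : List ℤ) : irredTest l = true ↔ (ofCoeffs l).Monic ∧ Irreducible (ofCoeffs l) := by
  set f := trim l with hf
  set F := ofCoeffs l with hF
  have hFf : ofCoeffs f = F := by rw [hf, ofCoeffs_trim]
  have hmon_iff : F.Monic ↔ f.getLast? = some 1 := monic_iff_getLast?_trim l
  by_cases hlast : f.getLast? = some 1
  swap
  · have hres : irredTest l = false := by rw [irredTest, ← hf, if_neg hlast]
    rw [hres]
    simp only [Bool.false_eq_true, false_iff, not_and]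
    exact fun hm => absurd (hmon_iff.1 hm) hlast
  have hmon : F.Monic := hmon_iff.2 hlast
  have hfne : f ≠ [] := fun h => by rw [h] at hlast; simp at hlast
  have hres : irredTest l = irredTestMonic f := by rw [irredTest, ← hf, if_pos hlast]
  rw [hres, irredTestMonic]
  set n := f.length - 1 with hn
  have hML : MonicList f n := ⟨by rw [hn]; have := List.length_pos_of_ne_nil hfne; omega, hlast⟩
  obtain ⟨hFm, hFd⟩ := hML.monic_ofCoeffs
  rw [hFf] at hFm hFd
  by_cases hn0 : n = 0
  · rw [if_pos hn0]
    simp only [Bool.false_eq_true, false_iff, not_and]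
    intro _ hirr
    have : F = 1 := eq_one_of_monic_natDegree_zero hmon (by rw [hFd, hn0])
    exact hirr.not_isUnit (this ▸ isUnit_one)
  rw [if_neg hn0]
  by_cases hn1 : n = 1
  · rw [if_pos hn1]
    simp only [true_iff]
    exact ⟨hmon, irreducible_of_monic_natDegree_one hmon (by rw [hFd, hn1])⟩
  rw [if_neg hn1]
  have hn2 : 2 ≤ n := by omega
  cases hgp : goodPrime f with
  | none =>
    simp only [Bool.false_eq_true, false_iff, not_and]
    intro _ hirr
    exact goodPrime_ne_none_of_irreducible hML (hFf ▸ hirr) hgp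
  | some p =>
    show irredTestCore f n p = true ↔ _
    obtain ⟨hprime, -, hsep⟩ := goodPrime_some hgp
    haveI : Fact p.Prime := ⟨hprime⟩
    have hp0 := hprime.pos
    rw [hFf] at hsep
    set φ := Int.castRingHom (ZMod p) with hφ
    have hsq : Squarefree (F.map φ) := hsep.squarefree
    -- `f mod p`
    set fp := pnorm p f with hfp
    have hfpZ : toZMod p fp = F.map φ := by rw [hfp, toZMod_pnorm, toZMod, hFf]
    have hfpn : Normal p fp := normal_pnorm hp0 _
    have hfpm : (toZMod p fp).Monic := by rw [hfpZ]; exact hmon.map φ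
    have hfpd0 : (toZMod p fp).natDegree = n := by rw [hfpZ, hmon.natDegree_map, hFd]
    have hfpne : fp ≠ [] := fun h => by have := hfpm.ne_zero; rw [h, toZMod_nil] at this; exact this rfl
    have hfplen : fp.length = n + 1 := by
      have := (hfpn.natDegree_toZMod hfpne).1; rw [hfpd0] at this
      have := List.length_pos_of_ne_nil hfpne; omega
    have hfpd : (toZMod p fp).natDegree = fp.length - 1 := by rw [hfpd0, hfplen]; rfl
    -- Berlekamp
    obtain ⟨hun, hum, hud, huirr, hudvd, hu2, hule⟩ :=
      berlekampFactor_spec hfpn hfpm hfpd (by omega) (by rw [hfpZ]; exact hsq)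
    rw [irredTestCore, ← hfp]
    set u₁ := berlekampFactor p fp with hu₁
    set d := u₁.length - 1 with hd
    have hd1 : 1 ≤ d := by omega
    have hdn : d ≤ n := by omega
    rw [hfpZ] at hudvd
    by_cases hdeq : d = n
    · rw [if_pos hdeq]
      simp only [true_iff]
      refine ⟨hmon, ?_⟩
      -- `ū = f̄`, so `f̄` is irreducible, so `f` is
      have heq : F.map φ = toZMod p u₁ :=
        eq_of_monic_of_dvd_of_natDegree_le hum (hmon.map φ) hudvd (by rw [hmon.natDegree_map, hFd, hud]; omega)
      exact hmon.irreducible_of_irreducible_map φ F (heq ▸ huirr)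
    rw [if_neg hdeq]
    have hdlt : d < n := lt_of_le_of_ne hdn hdeq
    -- Hensel
    have hune : u₁ ≠ [] := by rintro h; rw [h] at hu2; simp at hu2
    have hcof : toZMod p (henselCofactor p f u₁) = F.map φ /ₘ toZMod p u₁ := by
      rw [henselCofactor, toZMod_pnorm, (toZMod_pdivmod hp0 hune hum hud).1, toZMod, hFf]
    have hdvdf : toZMod p u₁ ∣ toZMod p f := by rw [show toZMod p f = F.map φ by rw [toZMod, hFf]]; exact hudvd
    have hcop : IsCoprime (toZMod p u₁) (toZMod p (henselCofactor p f u₁)) := by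
      rw [hcof]; exact isCoprime_cofactor hsq huirr hum hudvd
    set S : ℤ := (sqNormList f : ℤ) with hS
    set k := precisionExp n S with hk
    have hk1 : 1 ≤ k := Nat.le_add_left 1 _
    obtain ⟨hUml, -, hUp, hUmod⟩ := henselLift_spec hk1 hun hum hud hdvdf hcop
    set U := henselLift p k f u₁ with hU
    obtain ⟨hUm, hUd⟩ := hUml.monic_ofCoeffs
    rw [hFf] at hUmod
    -- the criterion
    have hSF : S = sqNorm F := by rw [hS, sqNormList_eq, hFf]
    have hK : precisionBound n (sqNorm F) < ((p ^ k : ℕ) : ℤ) ^ 2 := by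
      rw [← hSF]
      have h2k : (precisionBound n S).toNat < 2 ^ (k - 1) := by
        rw [hk, precisionExp, Nat.add_sub_cancel]; exact Nat.lt_size_self _
      have hpk : 2 ^ (k - 1) ≤ p ^ k :=
        (Nat.pow_le_pow_left hprime.two_le _).trans (Nat.pow_le_pow_right hp0 (Nat.sub_le _ _))
      have h1 : precisionBound n S < ((p ^ k : ℕ) : ℤ) := by
        have : ((precisionBound n S).toNat : ℤ) < ((p ^ k : ℕ) : ℤ) := by exact_mod_cast h2k.trans_le hpk
        exact (Int.self_le_toNat _).trans_lt this
      have h2 : ((p ^ k : ℕ) : ℤ) ≤ ((p ^ k : ℕ) : ℤ) ^ 2 := by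
        have : (1 : ℤ) ≤ (p ^ k : ℕ) := by exact_mod_cast Nat.one_le_pow k p hp0
        nlinarith
      exact h1.trans_le h2
    have hirrU : Irreducible ((ofCoeffs U).map φ) := by
      have : (ofCoeffs U).map φ = toZMod p u₁ := hUp; rw [this]; exact huirr
    have hcrit := irreducible_iff_testBound_lt hprime (by omega) hmon hFd hUm hUd (by omega) hdlt hirrU hsq hUmod hK
    have hI : (factorInstance n d (ofCoeffs U) (p ^ k)).IsNonsingular :=
      isNonsingular_factorInstance hUm hUd hdlt.le (pow_ne_zero _ hprime.ne_zero)
    rw [decide_eq_true_iff, hSF, firstRowSqNorm_eq hI (by omega)]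
    constructor
    · intro hlt; exact ⟨hmon, hcrit.2 hlt⟩
    · rintro ⟨-, hirr⟩; exact hcrit.1 hirr

end LLLFactoring

end Literature.Computability.Complexity
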